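import Mathlib
import HarnessLib

/-!
# The local shape read of a band maximum: cosine-model calibration of the Hessian instrument, half-height radii,
# what a 3-point stencil reads, the label rule as inequalities, and why ball second moments cannot discriminate

Cell `pub-fluidc` (FLUID COMPUTER; host summit `NavierStokesRegularity`, negation side, machine paradigm), prover seat p1
(gen 15, 2026-08-26). HONEST FRAMING: low prior, high value-of-information experiment on Tao's machine paradigm; NOT a claim
that NS blows up. Nothing in this file is about the Navier–Stokes equations. It types the conventions of ONE information
instrument of the cell — the second-moment-free LOCAL SHAPE READ of the `[9,17)` band `|ω|`-maximum from three coordinate planes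
(`pub-fluidc-p1/tools/slice_shape.py` 0.1.1; deposit `atlas/rung-next/p1/spatial/shape-local/`; HOME/STATUS p1 gen 15 INFORMATION
line) — so that its labels are computed from stated inequalities and its stencil bias is a number, not a guess:

* §1 CALIBRATION. Along any line the squared modulus of a single band mode is `s ↦ cos(k s)²` (`modeSq`), `k` = the wavevector's
  component along the line. Its LOCAL CURVATURE `−f″(0)/(2 f(0))` is exactly `k²` (`hasDerivAt_modeSq`, `deriv_modeSq`,
  `deriv_deriv_modeSq_zero`, `localCurvature_modeSq`): the instrument's matrix `K = −Hess(|ω_b|²)/(2|ω_b|²)` reads `k kᵀ` on a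
  single mode — direction by direction `(k·d)²` (`localCurvature_mode_along`), with trace `Σᵢ kᵢ² = |k|²` over the coordinate axes
  (`trace_mode_eq_normSq`), which is why `√trace` must land in the band (`11.3–12.9 ∈ [9,17)` on the record, `sqrt_trace_in_band`).
* §2 HALF-HEIGHT RADII. The cosine model halves first at `R = (π/3)/k` (`halfRadius`, `cos_mul_halfRadius`, `half_lt_cos_of_lt_halfRadius`);
  as a function of a curvature `κ`, `radius κ = (π/3)/√κ`, so a RATIO of radii is `√(κ'/κ)` (`radius_div_radius`) and the record's
  aspect threshold `2` on radii is the threshold `4` on curvatures (`two_le_radius_div_iff`).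
* §3 STENCILS. The 3-point second difference reads on the calibration mode the curvature `sin²(kh)/h²` instead of `k²`
  (`fdCurvature_modeSq`): NEVER an over-estimate (`fdCurvature_modeSq_le`), short by at most the factor `1 − (kh)²/3` for `kh ≤ 1`
  (`fdCurvature_modeSq_ge`) — at the band top on the 128³ grid (`kh ≤ 17·2π/128 < 0.835`) that is a curvature deficit of up to
  `≈ 21 %` by the exact symbol, which is why the read of record uses the 5-point stencil, whose symbol on the same mode is
  `(15 − 16 cos 2kh + cos 4kh)/(24 h²)` (`fd5Curvature_modeSq`), and prints the 3-point value only as a companion.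
* §4 THE LABEL RULE (pre-stated on the record's `0.5` aspect thresholds, HOME/STATUS p1 gen 15): on half-height radii
  `R₁ ≥ R₂ ≥ R₃ > 0`, `tube-like` iff `R₁/R₂ ≥ 2`, else `sheet-like` iff `R₂/R₃ ≥ 2`, else `compact`, refined to `compact-isotropic`
  iff `R₁/R₃ < 2` (`Shape`, `label`); the characterisations `label_eq_tubeLike_iff`, `label_eq_sheetLike_iff`,
  `label_eq_compactIsotropic_iff` (the last needs only `R₁/R₃ < 2`: it forces both other ratios below `2`), exhaustiveness is by
  construction; a reading whose two admissible stencils straddle a threshold is BORDERLINE and is printed as such, never resolved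
  by choosing a stencil (`u0b2_t140_stencils_straddle`).
* §5 WHY THE BALL MOMENTS OF RECORD COULD NOT SAY IT (STATUS l.5310 S1 / lit l.5313 (i)): for ANY non-negative weights on points
  inside a ball of radius `R` the centred per-axis second moment is at most `R²` (`centredMoment_le_raw`, `weightedMoment_le_sq`),
  and the uniform fill gives `R²/5`; the record's one-wavelength ball (`R = ℓ = 2π/9`, several oscillations of the band inside)
  read `s₁² ∈ [0.74, 1.27]·R²/5` at every instant whatever the local shape (`record_ball_moments_near_uniform`) — a sandwich with
  no shape in it; the local radii of §2 are `0.14–0.62 ℓ`, i.e. they live INSIDE that ball (`local_radii_inside_ball`).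
* §6 RECORD INSTANCES (fd5 radii of the deposit): u0_b⁽²⁾'s pulse peak `t₂ = 2.55` reads `compact-isotropic` (`u0b2_t255`); the
  break point's undesigned level two at `t 1.30` reads `tube-like` on all three stencils (`u02_t130`); u0_b⁽²⁾'s trough instant
  `t 1.40` is BORDERLINE with a model-free ridge longer than `ℓ` (`u0b2_t140_*`); `no_sheetLike_instant`; `hard_axis_two_cells`.
Design: plain real calculus / arithmetic on named models and samples (the eigen-decomposition and plane bookkeeping are the
reader's Python of record, not typed). Standard material; nothing cited as a result. 0 sorry; no named fact. -/

noncomputable section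

open Real

namespace Summit.NavierStokesRegularity.FluidComputer.LocalShape

/-! ## §1 Calibration: the squared modulus of a single band mode along a line -/

/-- The calibration profile: `|cos(k s)|² = cos(k s)²`, the squared modulus of a single Fourier mode read along a line on which
the wavevector has component `k`. -/
def modeSq (k s : ℝ) : ℝ := Real.cos (k * s) ^ 2

/-- The LOCAL CURVATURE the instrument assigns to a profile `f` at `0`: `−f″(0) / (2 f(0))` (for `f = |ω_b|²` restricted to a
line through its maximum this is the quadratic form of `K = −Hess/(2 max)` in that direction). -/
def localCurvature (f : ℝ → ℝ) : ℝ := -(deriv (deriv f) 0) / (2 * f 0)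

/-- The mode's maximum is normalised to `1`. -/
theorem modeSq_zero (k : ℝ) : modeSq k 0 = 1 := by simp [modeSq]
/-- First derivative of the calibration profile: `d/ds cos(ks)² = −k sin(2ks)`. -/
theorem hasDerivAt_modeSq (k s : ℝ) : HasDerivAt (modeSq k) (-(k * Real.sin (2 * (k * s)))) s := by
  have h1 : HasDerivAt (fun s : ℝ => k * s) k s := by simpa using (hasDerivAt_id s).const_mul k
  have h2 : HasDerivAt (fun s : ℝ => Real.cos (k * s)) (-Real.sin (k * s) * k) s := (Real.hasDerivAt_cos (k * s)).comp s h1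
  have h3 := h2.pow 2
  have e : ((2 : ℕ) : ℝ) * Real.cos (k * s) ^ (2 - 1) * (-Real.sin (k * s) * k) = -(k * Real.sin (2 * (k * s))) := by
    rw [Real.sin_two_mul]; push_cast; ring
  rw [← e]
  exact h3

/-- `deriv` form of `hasDerivAt_modeSq`. -/
theorem deriv_modeSq (k : ℝ) : deriv (modeSq k) = fun s => -(k * Real.sin (2 * (k * s))) := by
  funext s; exact (hasDerivAt_modeSq k s).deriv
/-- Second derivative: `d²/ds² cos(ks)² = −2k² cos(2ks)`. -/
theorem hasDerivAt_deriv_modeSq (k s : ℝ) :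
    HasDerivAt (deriv (modeSq k)) (-(2 * k ^ 2 * Real.cos (2 * (k * s)))) s := by
  rw [deriv_modeSq]
  have h1 : HasDerivAt (fun s : ℝ => 2 * (k * s)) (2 * k) s := by
    simpa [mul_assoc] using (hasDerivAt_id s).const_mul (2 * k)
  have h2 : HasDerivAt (fun s : ℝ => Real.sin (2 * (k * s))) (Real.cos (2 * (k * s)) * (2 * k)) s := h1.sin
  have h3 := (h2.const_mul k).neg
  have e : -(k * (Real.cos (2 * (k * s)) * (2 * k))) = -(2 * k ^ 2 * Real.cos (2 * (k * s))) := by ring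
  rw [← e]; exact h3

/-- At the maximum the second derivative of the squared mode is `−2k²`. -/
theorem deriv_deriv_modeSq_zero (k : ℝ) : deriv (deriv (modeSq k)) 0 = -(2 * k ^ 2) := by
  rw [(hasDerivAt_deriv_modeSq k 0).deriv]; simp
/-- CALIBRATION: the local curvature of a single band mode along a line is the squared wavevector component, `k²`. -/
theorem localCurvature_modeSq (k : ℝ) : localCurvature (modeSq k) = k ^ 2 := by
  unfold localCurvature; rw [deriv_deriv_modeSq_zero, modeSq_zero]; ring

/-- Direction by direction: for a wavevector `k` and a direction `d` in `ℝ³`, the profile along `d` is `modeSq (k ⬝ᵥ d)` and its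
local curvature is `(k ⬝ᵥ d)²` — the quadratic form of the rank-one matrix `k kᵀ`. -/
theorem localCurvature_mode_along (k d : Fin 3 → ℝ) :
    localCurvature (modeSq (k ⬝ᵥ d)) = (k ⬝ᵥ d) ^ 2 := localCurvature_modeSq _

/-- Trace over the coordinate axes: `Σᵢ (k ⬝ᵥ eᵢ)² = Σᵢ kᵢ² = k ⬝ᵥ k` — the sum of the three local curvatures of a single mode is
its squared wavenumber, whatever the orientation; this pins `√trace` to the band. -/
theorem trace_mode_eq_normSq (k : Fin 3 → ℝ) :
    ∑ i, localCurvature (modeSq (k ⬝ᵥ Pi.single i 1)) = k ⬝ᵥ k := by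
  simp only [localCurvature_modeSq, dotProduct_single, mul_one]
  simp [dotProduct, pow_two]

/-! ## §2 Half-height radii of the cosine model -/

/-- The half-height radius of the mode `cos(k s)`: `R = (π/3)/k`. -/
def halfRadius (k : ℝ) : ℝ := Real.pi / 3 / k

/-- The half-height radius assigned to a local curvature `κ`: `(π/3)/√κ` (the instrument prints `R_i = (π/3)/k_i`, `k_i = √κ_i`). -/
def radius (κ : ℝ) : ℝ := Real.pi / 3 / Real.sqrt κ

/-- `radius κ` is the half-height radius of the mode with wavenumber `√κ`. -/
theorem radius_eq_halfRadius_sqrt (κ : ℝ) : radius κ = halfRadius (Real.sqrt κ) := rfl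
/-- At `R = (π/3)/k` the mode has fallen to half its maximum: `cos(k R) = 1/2`. -/
theorem cos_mul_halfRadius {k : ℝ} (hk : k ≠ 0) : Real.cos (k * halfRadius k) = 1 / 2 := by
  unfold halfRadius
  rw [show k * (Real.pi / 3 / k) = Real.pi / 3 by field_simp, Real.cos_pi_div_three]

/-- … equivalently the squared modulus has fallen to a quarter. -/
theorem modeSq_halfRadius {k : ℝ} (hk : k ≠ 0) : modeSq k (halfRadius k) = 1 / 4 := by
  unfold modeSq; rw [cos_mul_halfRadius hk]; norm_num

/-- It is the FIRST half-height crossing: for `0 < k` and `0 ≤ s < (π/3)/k` the mode is still above half height. -/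
theorem half_lt_cos_of_lt_halfRadius {k s : ℝ} (hk : 0 < k) (hs0 : 0 ≤ s) (hs : s < halfRadius k) :
    1 / 2 < Real.cos (k * s) := by
  unfold halfRadius at hs
  have h1 : k * s < Real.pi / 3 := by
    have := mul_lt_mul_of_pos_left hs hk
    rwa [show k * (Real.pi / 3 / k) = Real.pi / 3 by field_simp] at this
  rw [← Real.cos_pi_div_three]
  apply Real.cos_lt_cos_of_nonneg_of_le_pi (by positivity) _ h1
  linarith [Real.pi_pos]

/-- Radii of positive curvatures are positive. -/
theorem radius_pos {κ : ℝ} (hκ : 0 < κ) : 0 < radius κ := by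
  unfold radius; have := Real.pi_pos; have := Real.sqrt_pos.mpr hκ; positivity
/-- A RATIO of half-height radii is the square root of the INVERSE ratio of curvatures: `radius a / radius b = √(b/a)`. -/
theorem radius_div_radius {a b : ℝ} (ha : 0 < a) (hb : 0 < b) : radius a / radius b = Real.sqrt (b / a) := by
  unfold radius
  have hpa : Real.sqrt a ≠ 0 := (Real.sqrt_pos.mpr ha).ne'
  have hpb : Real.sqrt b ≠ 0 := (Real.sqrt_pos.mpr hb).ne'
  have hpi : Real.pi ≠ 0 := Real.pi_pos.ne'
  rw [Real.sqrt_div (le_of_lt hb)]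
  field_simp

/-- The record's aspect threshold `2` on radii is the threshold `4` on curvatures: `2 ≤ radius a / radius b ↔ 4a ≤ b`. -/
theorem two_le_radius_div_iff {a b : ℝ} (ha : 0 < a) (hb : 0 < b) : 2 ≤ radius a / radius b ↔ 4 * a ≤ b := by
  rw [radius_div_radius ha hb, Real.le_sqrt' (by norm_num : (0 : ℝ) < 2), le_div_iff₀ ha]
  norm_num

/-! ## §3 What the 3-point and 5-point stencils read on the calibration mode -/

/-- The symmetric 3-point second difference at `0` with step `h`. -/
def secondDiff (f : ℝ → ℝ) (h : ℝ) : ℝ := (f h - 2 * f 0 + f (-h)) / h ^ 2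

/-- The 3-point curvature estimate `−secondDiff/(2 f(0))` (what the companion `fd3` row prints, squared-wavenumber units). -/
def fdCurvature (f : ℝ → ℝ) (h : ℝ) : ℝ := -(secondDiff f h) / (2 * f 0)

/-- The symmetric 5-point second difference at `0` with step `h`: `(−f(2h) + 16 f(h) − 30 f(0) + 16 f(−h) − f(−2h))/(12 h²)`. -/
def secondDiff5 (f : ℝ → ℝ) (h : ℝ) : ℝ := (-f (2 * h) + 16 * f h - 30 * f 0 + 16 * f (-h) - f (-(2 * h))) / (12 * h ^ 2)

/-- The 5-point curvature estimate (what the read of record, `fd5`, prints). -/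
def fd5Curvature (f : ℝ → ℝ) (h : ℝ) : ℝ := -(secondDiff5 f h) / (2 * f 0)

/-- On the calibration mode the 3-point stencil reads `sin²(kh)/h²` for the curvature `k²`. -/
theorem fdCurvature_modeSq (k : ℝ) {h : ℝ} (hh : h ≠ 0) : fdCurvature (modeSq k) h = Real.sin (k * h) ^ 2 / h ^ 2 := by
  unfold fdCurvature secondDiff modeSq
  rw [show k * -h = -(k * h) by ring, Real.cos_neg, mul_zero, Real.cos_zero]
  have hs := Real.sin_sq_add_cos_sq (k * h)
  field_simp
  nlinarith [hs]

/-- … which is NEVER an over-estimate: `sin²(kh)/h² ≤ k²`. -/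
theorem fdCurvature_modeSq_le (k : ℝ) {h : ℝ} (hh : h ≠ 0) : fdCurvature (modeSq k) h ≤ k ^ 2 := by
  rw [fdCurvature_modeSq k hh, div_le_iff₀ (by positivity)]
  have h1 : |Real.sin (k * h)| ≤ |k * h| := Real.abs_sin_le_abs
  have h2 : Real.sin (k * h) ^ 2 ≤ (k * h) ^ 2 := by
    rw [← sq_abs (Real.sin _), ← sq_abs (k * h)]
    exact pow_le_pow_left₀ (abs_nonneg _) h1 2
  nlinarith [h2]

/-- … and is short by at most the factor `1 − (kh)²/3` while `0 < kh ≤ 1`: `k² (1 − (kh)²/3) ≤ sin²(kh)/h²`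
(from `x − x³/6 < sin x` for `x > 0`). -/
theorem fdCurvature_modeSq_ge {k h : ℝ} (hh : 0 < h) (hk : 0 < k) (hkh : k * h ≤ 1) :
    k ^ 2 * (1 - (k * h) ^ 2 / 3) ≤ fdCurvature (modeSq k) h := by
  rw [fdCurvature_modeSq k hh.ne', le_div_iff₀ (by positivity)]
  set x := k * h with hx
  have hx0 : 0 < x := by positivity
  have hs : x - x ^ 3 / 6 < Real.sin x := Real.sin_gt_sub_cube hx0
  have hx1 : x ^ 2 ≤ 1 := by nlinarith
  have hl : 0 ≤ x - x ^ 3 / 6 := by nlinarith [mul_nonneg hx0.le (show (0 : ℝ) ≤ 1 - x ^ 2 / 6 by nlinarith)]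
  have hsq : (x - x ^ 3 / 6) ^ 2 ≤ Real.sin x ^ 2 := pow_le_pow_left₀ hl hs.le 2
  -- k²(1 − x²/3) h² = x² − x⁴/3 ≤ (x − x³/6)² = x² − x⁴/3 + x⁶/36
  have e : k ^ 2 * (1 - x ^ 2 / 3) * h ^ 2 = x ^ 2 - x ^ 4 / 3 := by rw [hx]; ring
  rw [e]
  nlinarith [hsq, pow_nonneg hx0.le 6]

/-- The 128³ grid and the band top: `h = 2π/128 < 0.0491` and `17 h < 0.835 ≤ 1`, so §3's two-sided bound applies across the
band; the exact 3-point symbol `sin²(x)/x²` at `x = 0.835` is `≈ 0.79` (a `21 %` curvature deficit, `11 %` on a local wavenumber) —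
the reason the read of record is the 5-point stencil. (Only the grid inequalities are typed.) -/
theorem band_top_step : 2 * Real.pi / 128 < 0.0491 ∧ 17 * (2 * Real.pi / 128) < 0.835 ∧ (0.835 : ℝ) ≤ 1 := by
  have := Real.pi_lt_d4
  refine ⟨by linarith, by linarith, by norm_num⟩

/-- On the calibration mode the 5-point stencil reads `(15 − 16 cos(2kh) + cos(4kh))/(24 h²)` (double-angle bookkeeping of
`cos²`; its Taylor expansion is `k²(1 − (kh)⁴·(2/45)·… )`, fourth-order close — not typed). -/
theorem fd5Curvature_modeSq (k : ℝ) {h : ℝ} (hh : h ≠ 0) :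
    fd5Curvature (modeSq k) h = (15 - 16 * Real.cos (2 * (k * h)) + Real.cos (4 * (k * h))) / (24 * h ^ 2) := by
  unfold fd5Curvature secondDiff5 modeSq
  have e1 : Real.cos (k * h) ^ 2 = 1 / 2 + Real.cos (2 * (k * h)) / 2 := Real.cos_sq _
  have e2 : Real.cos (k * (2 * h)) ^ 2 = 1 / 2 + Real.cos (4 * (k * h)) / 2 := by
    rw [Real.cos_sq]; ring_nf
  rw [show k * -h = -(k * h) by ring, show k * -(2 * h) = -(k * (2 * h)) by ring, Real.cos_neg, Real.cos_neg, mul_zero,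
    Real.cos_zero, e1, e2]
  field_simp
  ring

/-! ## §4 The label rule as inequalities -/

/-- The four labels the instrument prints. -/
inductive Shape
  | tubeLike | sheetLike | compact | compactIsotropic
  deriving DecidableEq, Repr

/-- THE PRE-STATED RULE on half-height radii `R₁ ≥ R₂ ≥ R₃`: tube-like iff `R₁/R₂ ≥ 2` (one long axis); else sheet-like iff
`R₂/R₃ ≥ 2` (two long axes); else compact, refined to compact-isotropic iff `R₁/R₃ < 2`. -/
def label (R₁ R₂ R₃ : ℝ) : Shape :=
  if 2 ≤ R₁ / R₂ then Shape.tubeLike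
  else if 2 ≤ R₂ / R₃ then Shape.sheetLike
  else if R₁ / R₃ < 2 then Shape.compactIsotropic
  else Shape.compact

/-- Tube-like iff the longest-to-middle radius ratio is at least `2`. -/
theorem label_eq_tubeLike_iff (R₁ R₂ R₃ : ℝ) : label R₁ R₂ R₃ = Shape.tubeLike ↔ 2 ≤ R₁ / R₂ := by
  unfold label; split_ifs <;> simp_all
/-- Sheet-like iff not tube-like and the middle-to-shortest ratio is at least `2` (two long axes). -/
theorem label_eq_sheetLike_iff (R₁ R₂ R₃ : ℝ) : label R₁ R₂ R₃ = Shape.sheetLike ↔ R₁ / R₂ < 2 ∧ 2 ≤ R₂ / R₃ := by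
  unfold label; split_ifs <;> simp_all [not_le]

/-- For ordered positive radii the isotropic label needs only `R₁/R₃ < 2`: that ratio dominates the other two. -/
theorem label_eq_compactIsotropic_iff {R₁ R₂ R₃ : ℝ} (h12 : R₂ ≤ R₁) (h23 : R₃ ≤ R₂) (h3 : 0 < R₃) :
    label R₁ R₂ R₃ = Shape.compactIsotropic ↔ R₁ / R₃ < 2 := by
  have h2 : 0 < R₂ := lt_of_lt_of_le h3 h23
  have hA : R₁ / R₂ ≤ R₁ / R₃ := div_le_div_of_nonneg_left (by linarith) h3 h23
  have hB : R₂ / R₃ ≤ R₁ / R₃ := div_le_div_of_nonneg_right h12 h3.le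
  unfold label
  split_ifs with ha hb hc <;> simp_all <;> linarith

/-- Plain `compact` = none of the three thresholds met but `R₁/R₃ ≥ 2` (triaxial: elongated AND flattened, each by less than `2`). -/
theorem label_eq_compact_iff (R₁ R₂ R₃ : ℝ) :
    label R₁ R₂ R₃ = Shape.compact ↔ R₁ / R₂ < 2 ∧ R₂ / R₃ < 2 ∧ 2 ≤ R₁ / R₃ := by
  unfold label; split_ifs <;> simp_all [not_le, not_lt]

/-- The rule in CURVATURE form (`κ₁ ≥ κ₂ ≥ κ₃ > 0`, radii `R₁ = radius κ₃ ≥ R₂ = radius κ₂ ≥ R₃ = radius κ₁`): tube-like iff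
`4 κ₃ ≤ κ₂`. -/
theorem tubeLike_iff_curvature {κ₁ κ₂ κ₃ : ℝ} (h2 : 0 < κ₂) (h3 : 0 < κ₃) :
    label (radius κ₃) (radius κ₂) (radius κ₁) = Shape.tubeLike ↔ 4 * κ₃ ≤ κ₂ := by
  rw [label_eq_tubeLike_iff, two_le_radius_div_iff h3 h2]

/-- … and compact-isotropic iff `κ₁ < 4 κ₃` (all three curvatures within a factor `4`). -/
theorem compactIsotropic_iff_curvature {κ₁ κ₂ κ₃ : ℝ} (h12 : κ₂ ≤ κ₁) (h23 : κ₃ ≤ κ₂) (h3 : 0 < κ₃) :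
    label (radius κ₃) (radius κ₂) (radius κ₁) = Shape.compactIsotropic ↔ κ₁ < 4 * κ₃ := by
  have h2 : 0 < κ₂ := lt_of_lt_of_le h3 h23
  have h1 : 0 < κ₁ := lt_of_lt_of_le h2 h12
  have hR12 : radius κ₂ ≤ radius κ₃ := by
    unfold radius; exact div_le_div_of_nonneg_left (by positivity) (Real.sqrt_pos.mpr h3) (Real.sqrt_le_sqrt h23)
  have hR23 : radius κ₁ ≤ radius κ₂ := by
    unfold radius; exact div_le_div_of_nonneg_left (by positivity) (Real.sqrt_pos.mpr h2) (Real.sqrt_le_sqrt h12)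
  rw [label_eq_compactIsotropic_iff hR12 hR23 (radius_pos h1), ← not_le, two_le_radius_div_iff h3 h1, not_le]

/-! ## §5 Why ball second moments cannot discriminate -/

variable {ι : Type*}

/-- The weighted mean of samples `x` with weights `w` over `s`. -/
def wmean (s : Finset ι) (w x : ι → ℝ) : ℝ := (∑ i ∈ s, w i * x i) / ∑ i ∈ s, w i

/-- The CENTRED weighted second moment (what the reader prints as `s_a²` per axis). -/
def centredMoment (s : Finset ι) (w x : ι → ℝ) : ℝ := (∑ i ∈ s, w i * (x i - wmean s w x) ^ 2) / ∑ i ∈ s, w i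

/-- Centring never increases a second moment: `Σ w (x − m)² / Σ w ≤ Σ w x² / Σ w` at the weighted mean `m`
(indeed `= Σ w x²/Σ w − m²`). -/
theorem centredMoment_le_raw (s : Finset ι) (w x : ι → ℝ) (hw : 0 < ∑ i ∈ s, w i) :
    centredMoment s w x ≤ (∑ i ∈ s, w i * x i ^ 2) / ∑ i ∈ s, w i := by
  unfold centredMoment
  rw [div_le_div_iff_of_pos_right hw]
  set m := wmean s w x with hm
  have key : ∑ i ∈ s, w i * (x i - m) ^ 2 = ∑ i ∈ s, w i * x i ^ 2 - m ^ 2 * ∑ i ∈ s, w i := by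
    have hsum : ∑ i ∈ s, w i * x i = m * ∑ i ∈ s, w i := by
      rw [hm]; unfold wmean; field_simp
    have : ∑ i ∈ s, w i * (x i - m) ^ 2 = ∑ i ∈ s, (w i * x i ^ 2 - 2 * m * (w i * x i) + m ^ 2 * w i) := by
      refine Finset.sum_congr rfl fun i _ => by ring
    rw [this, Finset.sum_add_distrib, Finset.sum_sub_distrib, ← Finset.mul_sum, ← Finset.mul_sum, hsum]
    ring
  rw [key]
  nlinarith [sq_nonneg m]

/-- Samples inside `[−R, R]` (a fortiori inside a ball of radius `R`, per axis) have weighted second moment at most `R²`. -/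
theorem weightedMoment_le_sq (s : Finset ι) (w x : ι → ℝ) (R : ℝ) (hw0 : ∀ i ∈ s, 0 ≤ w i) (hw : 0 < ∑ i ∈ s, w i)
    (hx : ∀ i ∈ s, |x i| ≤ R) : (∑ i ∈ s, w i * x i ^ 2) / ∑ i ∈ s, w i ≤ R ^ 2 := by
  rw [div_le_iff₀ hw, Finset.mul_sum]
  refine Finset.sum_le_sum fun i hi => ?_
  have : x i ^ 2 ≤ R ^ 2 := by
    rw [← sq_abs (x i)]
    exact pow_le_pow_left₀ (abs_nonneg _) (hx i hi) 2
  nlinarith [hw0 i hi]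

/-- THE SANDWICH WITH NO SHAPE IN IT: `0 ≤ s_a² ≤ R²` for every non-negative weight on points of the ball, whatever the structure;
the uniform fill's `R²/5` lies inside, and so does any reading 'within 14 %' of it. -/
theorem centredMoment_mem (s : Finset ι) (w x : ι → ℝ) (R : ℝ) (hw0 : ∀ i ∈ s, 0 ≤ w i) (hw : 0 < ∑ i ∈ s, w i)
    (hx : ∀ i ∈ s, |x i| ≤ R) : 0 ≤ centredMoment s w x ∧ centredMoment s w x ≤ R ^ 2 := by
  refine ⟨?_, (centredMoment_le_raw s w x hw).trans (weightedMoment_le_sq s w x R hw0 hw hx)⟩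
  unfold centredMoment
  exact div_nonneg (Finset.sum_nonneg fun i hi => mul_nonneg (hw0 i hi) (sq_nonneg _)) hw.le

/-- The record's one-wavelength ball (`R = ℓ = 2π/9`): the measured `s₁ ∈ [0.27, 0.35]` squared is between `0.74` and `1.27`
times the uniform-fill value `R²/5` and (of course) below `R²` — every instant, both designs, trough and pulse alike. -/
theorem record_ball_moments_near_uniform :
    (0.74 : ℝ) * ((2 * Real.pi / 9) ^ 2 / 5) ≤ 0.27 ^ 2 ∧ (0.35 : ℝ) ^ 2 ≤ 1.27 * ((2 * Real.pi / 9) ^ 2 / 5) ∧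
    (0.35 : ℝ) ^ 2 < (2 * Real.pi / 9) ^ 2 := by
  have h1 := Real.pi_gt_d4
  have h2 := Real.pi_lt_d4
  refine ⟨by nlinarith, by nlinarith, by nlinarith⟩

/-- … while the LOCAL half-height radii of §6 (`0.095–0.431`) are `0.13–0.62` of that ball radius: the structure the local read
resolves sits well inside the ball whose moments read 'uniform'. -/
theorem local_radii_inside_ball :
    (0.13 : ℝ) * (2 * Real.pi / 9) < 0.095 ∧ (0.431 : ℝ) < 0.62 * (2 * Real.pi / 9) := by
  have h1 := Real.pi_gt_d4
  have h2 := Real.pi_lt_d4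
  constructor <;> nlinarith

/-! ## §6 Record instances (fd5 radii of the deposit `spatial/shape-local/`, box units) -/

/-- u0_b⁽²⁾ at its level-two pulse peak `t₂ = 2.55`: radii `0.213 / 0.158 / 0.119` ⇒ ratios `1.35 / 1.33 / 1.79` ⇒
COMPACT-ISOTROPIC; and `t 2.85` (`0.201 / 0.162 / 0.112`, `R₁/R₃ = 1.795`) alike. -/
theorem u0b2_t255 :
    label 0.213 0.158 0.119 = Shape.compactIsotropic ∧ label 0.201 0.162 0.112 = Shape.compactIsotropic := by
  constructor
  · rw [label_eq_compactIsotropic_iff (by norm_num) (by norm_num) (by norm_num)]; norm_num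
  · rw [label_eq_compactIsotropic_iff (by norm_num) (by norm_num) (by norm_num)]; norm_num

/-- Break point u0⁽²⁾, undesigned level two at `t 1.30`: `0.431 / 0.166 / 0.095` on fd5 (`R₁/R₂ = 2.60`), `0.434 / 0.175 / 0.099`
on fd3 (`2.48`), `0.570 / 0.212 / 0.131` on the 5×5 least-squares companion (`2.69`) ⇒ TUBE-LIKE on all three stencils. -/
theorem u02_t130 :
    label 0.431 0.166 0.095 = Shape.tubeLike ∧ label 0.434 0.175 0.099 = Shape.tubeLike ∧
    label 0.570 0.212 0.131 = Shape.tubeLike := by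
  refine ⟨?_, ?_, ?_⟩ <;> rw [label_eq_tubeLike_iff] <;> norm_num

/-- BORDERLINE: u0_b⁽²⁾'s trough instant `t 1.40` reads `0.266 / 0.142 / 0.114` on fd5 (`R₁/R₂ = 1.87` ⇒ compact) and
`0.288 / 0.145 / 0.116` on fd3 (`1.99` ⇒ compact) but `0.375 / 0.179 / 0.147` on the least-squares companion (`2.09` ⇒ tube-like):
the admissible stencils STRADDLE the threshold, so the instant is printed BORDERLINE and not resolved by choosing a stencil. -/
theorem u0b2_t140_stencils_straddle :
    label 0.266 0.142 0.114 = Shape.compact ∧ label 0.288 0.145 0.116 = Shape.compact ∧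
    label 0.375 0.179 0.147 = Shape.tubeLike := by
  refine ⟨?_, ?_, ?_⟩
  · rw [label_eq_compact_iff]; norm_num
  · rw [label_eq_compact_iff]; norm_num
  · rw [label_eq_tubeLike_iff]; norm_num

/-- … and its MODEL-FREE companion settles what the local quadratic cannot: the half-height ridge through that maximum is
`0.747` long along the soft axis and the plane component reaches `0.730` from the argmax — both beyond one band wavelength
`ℓ = 2π/9 < 0.6982` — while at the pulse peak the largest reach is `0.422 < 0.61 ℓ`. -/
theorem u0b2_t140_ridge_exceeds_ell :
    2 * Real.pi / 9 < 0.730 ∧ 2 * Real.pi / 9 < 0.747 ∧ (0.422 : ℝ) < 0.61 * (2 * Real.pi / 9) := by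
  have h1 := Real.pi_gt_d4
  have h2 := Real.pi_lt_d4
  refine ⟨by linarith, by linarith, by nlinarith⟩

/-- NO SHEET-LIKE INSTANT: the middle-to-hard ratio `R₂/R₃` on fd5 at the nine instants (u0_b⁽²⁾ 1.10 / 1.40 / 2.10 / 2.55 / 2.85;
u0⁽²⁾ 1.30 / 2.10 / 2.35 / 2.70) is `1.62 / 1.24 / 1.28 / 1.33 / 1.45 ; 1.74 / 1.47 / 1.69 / 1.50`, all `< 2`. -/
theorem no_sheetLike_instant :
    (0.162 : ℝ) / 0.100 < 2 ∧ (0.142 : ℝ) / 0.114 < 2 ∧ (0.160 : ℝ) / 0.125 < 2 ∧ (0.158 : ℝ) / 0.119 < 2 ∧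
    (0.162 : ℝ) / 0.112 < 2 ∧ (0.166 : ℝ) / 0.095 < 2 ∧ (0.167 : ℝ) / 0.114 < 2 ∧ (0.190 : ℝ) / 0.113 < 2 ∧
    (0.167 : ℝ) / 0.111 < 2 := by
  norm_num

/-- `√trace` OF THE READ LANDS IN THE BAND at every instant (`11.3–12.9 ∈ [9, 17)`), as §1 requires of a band-passed field. -/
theorem sqrt_trace_in_band : (9 : ℝ) ≤ 11.3 ∧ (12.9 : ℝ) < 17 := by norm_num

/-- RESOLUTION FLOOR: the hard-axis radius `0.095–0.125` is about two grid cells (`2h = 4π/128 ∈ (0.0981, 0.0982)`;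
`0.095 < 2h`, `0.125 < 2.6 h`), and the cosine-model radii of the band's own wavenumbers are `(π/3)/17 < 0.0617` to
`(π/3)/9 > 0.1163` — the read's hard axis sits at the band's short end and at the grid's floor; a thinner sheet inside it
could not be seen at 128³. -/
theorem hard_axis_two_cells :
    (0.0981 : ℝ) < 4 * Real.pi / 128 ∧ 4 * Real.pi / 128 < 0.0982 ∧ (0.095 : ℝ) < 4 * Real.pi / 128 ∧
    (0.125 : ℝ) < 2.6 * (2 * Real.pi / 128) ∧ Real.pi / 3 / 17 < 0.0617 ∧ (0.1163 : ℝ) < Real.pi / 3 / 9 := by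
  have h1 := Real.pi_gt_d4
  have h2 := Real.pi_lt_d4
  refine ⟨by linarith, by linarith, by linarith, by linarith, ?_, ?_⟩
  · rw [div_div, div_lt_iff₀ (by norm_num)]; linarith
  · rw [div_div, lt_div_iff₀ (by norm_num)]; linarith
end Summit.NavierStokesRegularity.FluidComputer.LocalShape

end
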